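import Summits.PneNP.PneNP.Theses.CanonicalForms
import Literature.NumberTheory.NumberFields.NumberFieldCanonicalForms

/-!
# Route CanonicalForms — the split of the target `PEqNotCF` (stmt-PneNP-0947), Summits-side names

TO BE LANDED VERBATIM BY A PROVER (Theorems/ is prover-only; this file is attached as evidence on
stmt-PneNP-0947, on `NFIsoPEq` = stmt-PneNP-17824 and on `PEqNotCFOfSubs` = stmt-PneNP-17843). Everything is already proved in Literature
(`Literature/NumberTheory/NumberFields/NumberFieldCanonicalForms.lean`, p141323): this file only
restates it against the route decls, so that the accept-time probe CLOSES `NFIsoPEq` and `PEqNotCFOfSubs`.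
Propose with `--workitem stmt-PneNP-17843` (or 17824); the other item closes by the probe / `statement-close`.

* `canonicalForms_nfIsoPEq_proof : NFIsoPEq` — child 2 ("easy to compare"), proved;
* `canonicalForms_pEqNotCFOfSubs_proof : PEqNotCFOfSubs` — the glue support item (stmt-PneNP-17843) by name, proved;
* `canonicalForms_pEqNotCF_of_subs : NumberFieldNoCF → NFIsoPEq → PEqNotCF` — the same glue, arrows displayed
  (identical to the route's `--glue-by` theorem, recorded under a Summits name);
* `canonicalForms_pEqNotCF_of_numberFieldNoCF : NumberFieldNoCF → PEqNotCF` — the bridge.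
-/

set_option linter.dupNamespace false

namespace Summit.PneNP.PneNP.Theorems

open Summit.PneNP.PneNP.Theses.CanonicalForms

/-- Child 2 of the split of `PEqNotCF`: number-field isomorphism (invalid strings lumped) is a
`P`-decidable equivalence relation. [cite: Lenstra1992, §2.9] [cite: Landau1985, main theorem p. 184] -/
theorem canonicalForms_nfIsoPEq_proof : NFIsoPEq :=
  Literature.NumberTheory.NumberFields.nfIsoPEq_witness

/-- The glue support item `PEqNotCFOfSubs` (stmt-PneNP-17843) BY NAME — closes it on accept:
"hard to name ∧ easy to compare ⟹ CF ≠ PEq". [cite: FortnowGrochow2011, §1 (guiding question)] -/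
theorem canonicalForms_pEqNotCFOfSubs_proof : PEqNotCFOfSubs :=
  Literature.NumberTheory.NumberFields.pEq_not_CF_of_noCanonicalDefiningPoly

/-- The same glue with the arrows displayed (the `--glue-by` shape of the split).
[cite: FortnowGrochow2011, §1 (guiding question)] -/
theorem canonicalForms_pEqNotCF_of_subs : NumberFieldNoCF → NFIsoPEq → PEqNotCF :=
  Literature.NumberTheory.NumberFields.pEq_not_CF_of_noCanonicalDefiningPoly

/-- The bridge: `NumberFieldNoCF → PEqNotCF`. [cite: FortnowGrochow2011, §1 (guiding question)] -/
theorem canonicalForms_pEqNotCF_of_numberFieldNoCF : NumberFieldNoCF → PEqNotCF :=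
  Literature.NumberTheory.NumberFields.pEq_not_CF_of_noCanonicalDefiningPoly'

end Summit.PneNP.PneNP.Theorems
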